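import Literature.NumberTheory.Automorphic.Liu2021.Def411WeilCarriersTripleSeparation
import HarnessLib

/-!
# [Liu2021, App. D §D.1 Step 1 ∕ Def. 4.12] — the class of the Step-1 representative `(a·δ) ⊗ 1` in `E_v^{−×}/Nm E_v^×`
# IS the `v`-component of the collection `locF a`: the converse direction and the `iff`

Topic `NumberTheory/Automorphic/Liu2021`; namespace `Literature.NumberTheory.Automorphic.Liu2021.Def411WeilCarriers` (that of ★
`Def411WeilCarriersTripleSeparation`).  KERNEL ONLY: theorems; no definition, no named fact, no `sorry`.

★ `locF_apply_eq_of_sameClass_epsLine` (`Def411WeilCarriersTripleSeparation` §1) proves ONE direction of the dictionary between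
[Liu2021, App. D Lemma D.1]'s class clause «`ε' = ε` in `E_v^{−×}/Nm E_v^×`» for the Step-1 representatives `(a·δ) ⊗ 1`,
`(a'·δ) ⊗ 1` of two lines (`LemD1.SameClass (epsLine a v) (epsLine a' v)`) and the equality of the `v`-components of [Liu2021,
Def. 4.12]'s collections `locF a`, `locF a'` (classes in `F_v^×/Nm`, `Nm = {p² − d q²}`).  This file proves the CONVERSE
(`sameClass_epsLine_of_locF_apply_eq`: `a'/a = p² − d q² = N(ι_v p + ι_v q·δ)` and `x·(c ⊗ 1)x = ι_v(N x)`, ★ `toLocalRing_algebraNorm`,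
★ `algebraNorm_quadraticLocalEquiv`) and records the `iff` (`sameClass_epsLine_iff_locF_apply_eq`) together with its negated form
(`not_sameClass_epsLine_iff_locF_apply_ne`) — the shape in which the P5 residual R2′ of cell `hodgecm-mathlib`
(`Cruxes/HLiu418/Lines/F0_P5_CurveThetaLettersPaydown.lean`, `CompanionRelabelTransfer₂`: «`locF a' v = locF a v ↔ V_v` isotropic»)
feeds [Liu2021, Lemma D.1 (4)]'s clauses «`ε' = ε` when `V` is isotropic, `ε' ≠ ε` when `V` is anisotropic».  HC_CM is proved only
modulo the printed citations until rung 0 closes; this file proves no cell binder.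

## References
* [Liu2021] Y. Liu, *Fourier–Jacobi cycles and arithmetic relative trace formula*, Camb. J. Math. 9 (2021) = arXiv:2102.11518,
  Def. 4.12 (l. 2102–2108), App. D §D.1 Step 1 (l. 5217), Lemma D.1 (3)–(4) (l. 5233–5235).
* [CasselsFrohlichANT1967] J. W. S. Cassels, A. Fröhlich (eds.), *Algebraic Number Theory*, Ch. II §11 (local norm groups).
-/

set_option autoImplicit false

noncomputable section

open scoped Matrix NumberField
open NumberField IsDedekindDomain
open Literature.NumberTheory Literature.NumberTheory.Automorphic Literature.NumberTheory.Automorphic.UnitaryGroup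
open Literature.RepresentationTheory
open Literature.NumberTheory.QuadraticForms (quadraticNormSubgroup)

namespace Literature.NumberTheory.Automorphic.Liu2021.Def411WeilCarriers

variable (F E : Type) [Field F] [NumberField F] [Field E] [NumberField E] [Algebra F E]
variable (c : E ≃ₐ[F] E) (N : ℕ) (JV : Matrix (Fin N) (Fin N) E)
variable [Algebra.IsQuadraticExtension F E] {δ : E} (hcδ : c δ = -δ) (hδ : δ ≠ 0)

/-- **Converse of ★ `locF_apply_eq_of_sameClass_epsLine`**: if the `v`-components of the collections `locF a`, `locF a'` agree — i.e.
`a'/a` is a local norm, `a'/a = p² − d q²` for some `p, q ∈ F_v` — then the Step-1 representatives `(a·δ) ⊗ 1`, `(a'·δ) ⊗ 1` lie in the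
same class of `E_v^{−×}/Nm E_v^×`: with `x := ι_v p + ι_v q·δ ∈ E_v` one has `x·(c ⊗ 1)x = ι_v(N x) = ι_v(a'/a)` (★ `toLocalRing_algebraNorm`,
★ `algebraNorm_quadraticLocalEquiv`), `x` is a unit (its norm is), and `(a'·δ) ⊗ 1 = ι_v(a'/a)·((a·δ) ⊗ 1)` (★ `epsLine_eq_mul`).
[cite: Liu2021, App. D §D.1 Step 1 (l. 5217); Def. 4.12 (l. 2105)] [cite: CasselsFrohlichANT1967, Ch. II §11] -/
theorem sameClass_epsLine_of_locF_apply_eq {d : F} (hd : δ * δ = algebraMap F E d) (hN : 2 ≤ N) (hJh : (JV.map c)ᵀ = JV)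
    (hJdet : JV.det ≠ 0) (v : HeightOneSpectrum (𝓞 F)) (a a' : Fˣ) (h : locF F d a v = locF F d a' v) :
    LemD1.SameClass (S := LemD1OfPlace.standingData E v c N JV hcδ hδ hN hJh hJdet)
      ⟨epsLine E hδ a v, epsLine_mem_skew E c N JV hcδ hδ hN hJh hJdet a v⟩
      ⟨epsLine E hδ a' v, epsLine_mem_skew E c N JV hcδ hδ hN hJh hJdet a' v⟩ := by
  -- `t := a'/a` is a local norm
  set t : (v.adicCompletion F)ˣ := Units.map (algebraMap F (v.adicCompletion F)).toMonoidHom (a' * a⁻¹) with ht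
  have hmem : t ∈ quadraticNormSubgroup (v.adicCompletion F) (algebraMap F (v.adicCompletion F) d) := by
    rw [locF_apply, locF_apply, QuotientGroup.eq] at h
    have hta : (Units.map (algebraMap F (v.adicCompletion F)).toMonoidHom a)⁻¹ *
        Units.map (algebraMap F (v.adicCompletion F)).toMonoidHom a' = t := by
      rw [ht, map_mul, map_inv, mul_comm]
    rw [← hta]
    exact h
  obtain ⟨p, q, hpq⟩ := Literature.NumberTheory.QuadraticForms.mem_quadraticNormSubgroup_iff.1 hmem
  -- `x := ι_v p + ι_v q·δ` has norm `t`
  set x : LocalRing E v := quadraticLocalEquiv E v c hcδ hδ (p, q) with hx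
  have hNx : Algebra.norm (v.adicCompletion F) x = (t : v.adicCompletion F) := by
    have h1 : Algebra.norm (v.adicCompletion F) x = p * p - algebraMap F (v.adicCompletion F) d * (q * q) := by
      rw [hx]
      exact algebraNorm_quadraticLocalEquiv E v c hcδ hδ hd p q
    rw [h1, ← hpq]
    ring
  have hxc : x * conjLocal E c v x = toLocalRing E v (t : v.adicCompletion F) := by
    rw [← hNx, toLocalRing_algebraNorm E v c hcδ hδ x]
  have hxu : IsUnit x :=
    isUnit_of_mul_isUnit_left (by rw [hxc]; exact (Units.map (toLocalRing E v).toMonoidHom t).isUnit)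
  refine ⟨hxu.unit, ?_⟩
  -- `(a'·δ) ⊗ 1 = ι_v(a'/a) · ((a·δ) ⊗ 1) = x·(c ⊗ 1)x · ((a·δ) ⊗ 1)`
  change epsLine E hδ a' v = hxu.unit *
    Units.map ((LemD1OfPlace.standingData E v c N JV hcδ hδ hN hJh hJdet).σ : LocalRing E v →* LocalRing E v) hxu.unit * epsLine E hδ a v
  rw [epsLine_eq_mul F E hδ a a' v]
  congr 1
  refine Units.ext ?_
  rw [Units.coe_map, RingHom.toMonoidHom_eq_coe, MonoidHom.coe_coe, ← ht, ← hxc, Units.val_mul, Units.coe_map, IsUnit.unit_spec,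
    MonoidHom.coe_coe, Literature.RepresentationTheory.Liu2021.OscillatorStandingData.σ_apply, LemD1OfPlace.standingData_conj_apply]

/-- **THE DICTIONARY** between [Liu2021, App. D Lemma D.1]'s class clause for the Step-1 representatives of two lines at `v` and the
`v`-components of [Liu2021, Def. 4.12]'s collections: `(a·δ) ⊗ 1 ~ (a'·δ) ⊗ 1` in `E_v^{−×}/Nm E_v^×` iff `locF a v = locF a' v`
(★ `locF_apply_eq_of_sameClass_epsLine` and `sameClass_epsLine_of_locF_apply_eq`).
[cite: Liu2021, App. D §D.1 Step 1 (l. 5217); Lemma D.1 (3)–(4) (l. 5233–5235); Def. 4.12 (l. 2105)] -/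
theorem sameClass_epsLine_iff_locF_apply_eq {d : F} (hd : δ * δ = algebraMap F E d) (hN : 2 ≤ N) (hJh : (JV.map c)ᵀ = JV)
    (hJdet : JV.det ≠ 0) (v : HeightOneSpectrum (𝓞 F)) (a a' : Fˣ) :
    LemD1.SameClass (S := LemD1OfPlace.standingData E v c N JV hcδ hδ hN hJh hJdet)
        ⟨epsLine E hδ a v, epsLine_mem_skew E c N JV hcδ hδ hN hJh hJdet a v⟩
        ⟨epsLine E hδ a' v, epsLine_mem_skew E c N JV hcδ hδ hN hJh hJdet a' v⟩ ↔
      locF F d a v = locF F d a' v :=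
  ⟨locF_apply_eq_of_sameClass_epsLine F E c N JV hcδ hδ hd hN hJh hJdet v a a',
    sameClass_epsLine_of_locF_apply_eq F E c N JV hcδ hδ hd hN hJh hJdet v a a'⟩

/-- **The negated dictionary** (the anisotropic clause of [Liu2021, Lemma D.1 (4)]: «`ε' ≠ ε`»): the Step-1 representatives of the two lines
lie in DIFFERENT classes of `E_v^{−×}/Nm E_v^×` iff `locF a v ≠ locF a' v`. [cite: Liu2021, App. D Lemma D.1 (4) (l. 5235); Def. 4.12 (l. 2105)] -/
theorem not_sameClass_epsLine_iff_locF_apply_ne {d : F} (hd : δ * δ = algebraMap F E d) (hN : 2 ≤ N) (hJh : (JV.map c)ᵀ = JV)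
    (hJdet : JV.det ≠ 0) (v : HeightOneSpectrum (𝓞 F)) (a a' : Fˣ) :
    ¬ LemD1.SameClass (S := LemD1OfPlace.standingData E v c N JV hcδ hδ hN hJh hJdet)
        ⟨epsLine E hδ a v, epsLine_mem_skew E c N JV hcδ hδ hN hJh hJdet a v⟩
        ⟨epsLine E hδ a' v, epsLine_mem_skew E c N JV hcδ hδ hN hJh hJdet a' v⟩ ↔
      locF F d a v ≠ locF F d a' v :=
  (sameClass_epsLine_iff_locF_apply_eq F E c N JV hcδ hδ hd hN hJh hJdet v a a').not

end Literature.NumberTheory.Automorphic.Liu2021.Def411WeilCarriers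

end
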